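import Literature.NumberTheory.EllipticCurves.CyclotomicZpExtensionLayerTorsionProofs
import HarnessLib

/-!
# The uniformiser `π_n = ∏_{b ∈ Δ} (1 - ζ_{p^{n+1}}^b)` of the `n`-th layer of the cyclotomic `ℤ_p`-extension of `ℚ` (`p` odd)

`Proofs` file (theorems only: **no definition, no named fact, nothing asserted**) in topic `NumberTheory/EllipticCurves`,
sequel of `CyclotomicZpExtensionLayerTorsionProofs` (`σ ∈ Gal(ℚ̄/ℚ_n) ⇒ χ^{(p^{n+1})}(σ)^{p-1} = 1`) and the odd-`p` twin of
`CyclotomicZpExtensionLayerGeneratorProofs` (`ζ_{2^{n+2}} + ζ_{2^{n+2}}⁻¹ ∈ ℚ_n`). L. C. Washington, *Introduction to Cyclotomic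
Fields*, §13.1 and Lemma 1.4 / Prop. 2.8: `ℚ_n = ℚ(ζ_{p^{n+1}})^Δ` with `Δ ≅ (ℤ/p)^×` the `(p-1)`-torsion of `(ℤ/p^{n+1})^×`, and
`π_n = N_{ℚ(ζ_{p^{n+1}})/ℚ_n}(1 - ζ_{p^{n+1}}) = ∏_{b ∈ Δ} (1 - ζ^b)` generates the prime of `ℚ_n` above `p`.

* `card_filter_pow_sub_one_eq_one` — **`#Δ = p - 1`**, `Δ = {b ∈ (ℤ/p^{n+1})^× : b^{p-1} = 1}` (`(ℤ/p^{n+1})^×` is cyclic of order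
  `(p-1)pⁿ`, Mathlib `ZMod.isCyclic_units_of_prime_pow`: at most `p - 1` roots of `x^{p-1} = 1` (`IsCyclic.card_pow_eq_one_le`), and
  the `p - 1` powers of `g^{pⁿ}` for a generator `g`).
* `IsCyclotomic.smul_prod_one_sub_pow_of_mem_layerSubgroup` — **every `σ ∈ Gal(ℚ̄/ℚ_n)` fixes `π_n = ∏_{b ∈ Δ} (1 - ζ^b)`** for a
  primitive `p^{n+1}`-th root of unity `ζ ∈ ℚ̄` and every cyclotomic `ℤ_p`-extension `κ` of `ℚ`, `p` odd: `σ ζ = ζ^u` with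
  `u = χ^{(p^{n+1})}(σ) ∈ Δ`, and `b ↦ u b` permutes `Δ`.

(The absolute value `|π_n|^{pⁿ} = |p|` — each factor is `1 - ζ'` for a primitive root `ζ'`, and `|1 - ζ'|^{(p-1)pⁿ} = |p|` — is read
in `K̄_v` in the sequel `SelmerCorankControlRatOrdinaryLayerOddProofs`, which feeds Greenberg's Lemma 3.4 at the layer `n`.)

HONEST FRAMING (cell `bsd-f1-sign2`, WIDTH-5 attach seat `bsd-line-att-p5` g42 on crux stmt-BirchSwinnertonDyer-22298): cyclotomic
bookkeeping (Washington §13.1); closes no item; BSD is not proved by any of this.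

## References

* [Washington1997] L. C. Washington, *Introduction to Cyclotomic Fields*, 2nd ed. (1997), §13.1, Lemma 1.4, Prop. 2.8.

## Design

No definitions (the set `Δ` is spelled `Finset.univ.filter (fun b ↦ b ^ (p - 1) = 1)` in every statement); `noncomputable section`.
Axioms: `propext`, `Classical.choice`, `Quot.sound`.
-/

noncomputable section

open scoped NumberField Classical
open Field
open Literature.NumberTheory.GaloisRepresentations

namespace Literature.NumberTheory.EllipticCurves.ZpExtension

variable {p : ℕ} [hp : Fact p.Prime]

/-! ## §1 `#Δ = p - 1` -/

/-- **`#{b ∈ (ℤ/p^{n+1})^× : b^{p-1} = 1} = p - 1` for an odd prime `p`**: the unit group is cyclic of order `(p-1)pⁿ` (Mathlib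
`ZMod.isCyclic_units_of_prime_pow`), so `x^{p-1} = 1` has at most `p - 1` solutions (`IsCyclic.card_pow_eq_one_le`); and for a
generator `g`, the element `g^{pⁿ}` has order `p - 1`, whose `p - 1` distinct powers are solutions. (Washington §13.1:
`Gal(ℚ(ζ_{p^{n+1}})/ℚ_n) = Δ ≅ (ℤ/p)^×`.) [cite: Washington1997, §13.1] -/
theorem card_filter_pow_sub_one_eq_one (hp2 : p ≠ 2) (n : ℕ) :
    (Finset.univ.filter fun b : (ZMod (p ^ (n + 1)))ˣ ↦ b ^ (p - 1) = 1).card = p - 1 := by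
  have hpp := hp.out
  haveI : NeZero (p ^ (n + 1)) := ⟨pow_ne_zero _ hpp.ne_zero⟩
  haveI : IsCyclic (ZMod (p ^ (n + 1)))ˣ := ZMod.isCyclic_units_of_prime_pow p hpp hp2 (n + 1)
  have hp1 : 0 < p - 1 := by have := hpp.two_le; omega
  refine le_antisymm (IsCyclic.card_pow_eq_one_le hp1) ?_
  -- a generator `g` of order `(p-1) pⁿ`, and `h = g^{pⁿ}` of order `p - 1`
  obtain ⟨g, hg⟩ := IsCyclic.exists_generator (α := (ZMod (p ^ (n + 1)))ˣ)
  have hcard : Nat.card (ZMod (p ^ (n + 1)))ˣ = p ^ n * (p - 1) := by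
    rw [Nat.card_eq_fintype_card, ZMod.card_units_eq_totient, Nat.totient_prime_pow hpp (Nat.succ_pos n)]
    simp
  have hord : orderOf g = p ^ n * (p - 1) := by rw [orderOf_eq_card_of_forall_mem_zpowers hg, hcard]
  set h : (ZMod (p ^ (n + 1)))ˣ := g ^ p ^ n with hhdef
  have hordh : orderOf h = p - 1 := by
    rw [hhdef, orderOf_pow_of_dvd (pow_ne_zero _ hpp.ne_zero) (by rw [hord]; exact dvd_mul_right _ _), hord,
      Nat.mul_div_cancel_left _ (pow_pos hpp.pos _)]
  -- the `p - 1` distinct powers of `h`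
  have hsub : (Finset.range (p - 1)).image (fun i : ℕ ↦ h ^ i) ⊆
      Finset.univ.filter fun b : (ZMod (p ^ (n + 1)))ˣ ↦ b ^ (p - 1) = 1 := by
    intro b hb
    obtain ⟨i, -, rfl⟩ := Finset.mem_image.mp hb
    rw [Finset.mem_filter]
    refine ⟨Finset.mem_univ _, ?_⟩
    rw [← pow_mul, mul_comm, pow_mul, ← hordh, pow_orderOf_eq_one, one_pow]
  have hinj : Set.InjOn (fun i : ℕ ↦ h ^ i) (Finset.range (p - 1) : Set ℕ) := by
    intro i hi j hj hij
    rw [Finset.coe_range, ← hordh] at hi hj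
    exact pow_injOn_Iio_orderOf hi hj hij
  calc p - 1 = ((Finset.range (p - 1)).image (fun i : ℕ ↦ h ^ i)).card := by
        rw [Finset.card_image_of_injOn hinj, Finset.card_range]
    _ ≤ _ := Finset.card_le_card hsub

/-! ## §2 `Gal(ℚ̄/ℚ_n)` fixes `∏_{b ∈ Δ} (1 - ζ^b)` -/

/-- Powers of a root of unity only depend on the exponent modulo the order: `ζ^a = ζ^{a mod M}` for `ζ^M = 1`. [folklore] -/
private theorem pow_eq_pow_mod {F : Type*} [Monoid F] {ζ : F} {M : ℕ} (hζ : ζ ^ M = 1) (a : ℕ) :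
    ζ ^ a = ζ ^ (a % M) := by
  conv_lhs => rw [← Nat.mod_add_div a M, pow_add, pow_mul, hζ, one_pow, mul_one]

/-- For units `u, b` of `ℤ/M`: `(ζ^{u})^{b} = ζ^{(u b)}` on `.val` exponents, for `ζ^M = 1`. [folklore] -/
private theorem pow_val_pow_val_eq {F : Type*} [Monoid F] {ζ : F} {M : ℕ} [NeZero M] (hζ : ζ ^ M = 1)
    (u b : (ZMod M)ˣ) :
    (ζ ^ ((u : ZMod M)).val) ^ ((b : ZMod M)).val = ζ ^ (((u * b : (ZMod M)ˣ) : ZMod M)).val := by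
  rw [← pow_mul, Units.val_mul, ZMod.val_mul, ← pow_eq_pow_mod hζ]

/-- **Every `σ ∈ Gal(ℚ̄/ℚ_n)` fixes `π_n = ∏_{b ∈ Δ} (1 - ζ^b)`** (`ζ` a primitive — or any — `p^{n+1}`-th root of unity in `ℚ̄`,
`Δ = {b : b^{p-1} = 1} ≤ (ℤ/p^{n+1})^×`, `κ` ANY cyclotomic `ℤ_p`-extension of `ℚ`, `p` odd): `σ ζ = ζ^u` with
`u = χ^{(p^{n+1})}(σ)` (`modNCyclotomicCharacter_spec`), `u ∈ Δ` (`IsCyclotomic.modNCyclotomicCharacter_pow_eq_one_of_mem_layerSubgroup`),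
so `σ` permutes the factors (`b ↦ u b` is a bijection of `Δ`). Washington §13.1: `ℚ_n = ℚ(ζ_{p^{n+1}})^Δ` and
`N_{ℚ(ζ_{p^{n+1}})/ℚ_n}(1 - ζ) = ∏_{δ ∈ Δ} (1 - ζ^δ) ∈ ℚ_n`. [cite: Washington1997, §13.1] -/
theorem IsCyclotomic.smul_prod_one_sub_pow_of_mem_layerSubgroup {κ : ZpExtension ℚ p} (hκ : κ.IsCyclotomic) (hp2 : p ≠ 2)
    (n : ℕ) {ζ : AlgebraicClosure ℚ} (hζ : ζ ^ p ^ (n + 1) = 1) {σ : absoluteGaloisGroup ℚ} (hσ : σ ∈ κ.layerSubgroup n) :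
    haveI : NeZero (p ^ (n + 1)) := ⟨pow_ne_zero _ hp.out.ne_zero⟩
    σ • (∏ b ∈ Finset.univ.filter (fun b : (ZMod (p ^ (n + 1)))ˣ ↦ b ^ (p - 1) = 1),
        (1 - ζ ^ ((b : ZMod (p ^ (n + 1)))).val)) =
      ∏ b ∈ Finset.univ.filter (fun b : (ZMod (p ^ (n + 1)))ˣ ↦ b ^ (p - 1) = 1),
        (1 - ζ ^ ((b : ZMod (p ^ (n + 1)))).val) := by
  haveI : NeZero (p ^ (n + 1)) := ⟨pow_ne_zero _ hp.out.ne_zero⟩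
  set M : ℕ := p ^ (n + 1) with hMdef
  set Δ : Finset (ZMod M)ˣ := Finset.univ.filter (fun b : (ZMod M)ˣ ↦ b ^ (p - 1) = 1) with hΔdef
  have hΔmem : ∀ b : (ZMod M)ˣ, b ∈ Δ ↔ b ^ (p - 1) = 1 := fun b ↦ by
    rw [hΔdef, Finset.mem_filter]; exact ⟨fun h ↦ h.2, fun h ↦ ⟨Finset.mem_univ _, h⟩⟩
  -- `u = χ(σ) ∈ Δ` and `σ ζ = ζ^u`
  set u : (ZMod M)ˣ := modNCyclotomicCharacter ℚ M σ with hudef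
  have hu : u ∈ Δ := (hΔmem u).mpr (hκ.modNCyclotomicCharacter_pow_eq_one_of_mem_layerSubgroup hp2 n hMdef hσ)
  have hσζ : σ • ζ = ζ ^ ((u : ZMod M)).val := modNCyclotomicCharacter_spec ℚ M σ ζ hζ
  -- `σ` acts on the factors by `b ↦ u b`
  have hfac : ∀ b : (ZMod M)ˣ, σ • (1 - ζ ^ ((b : ZMod M)).val) = 1 - ζ ^ (((u * b : (ZMod M)ˣ) : ZMod M)).val := by
    intro b
    rw [smul_sub, smul_one, smul_pow', hσζ, pow_val_pow_val_eq hζ]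
  rw [Finset.smul_prod']
  -- reindex the product along the bijection `b ↦ u b` of `Δ`
  refine Finset.prod_nbij' (fun b ↦ u * b) (fun b ↦ u⁻¹ * b) (fun b hb ↦ ?_) (fun b hb ↦ ?_) (fun b _ ↦ ?_)
    (fun b _ ↦ ?_) (fun b _ ↦ hfac b)
  · rw [hΔmem] at hb hu ⊢
    rw [mul_pow, hu, hb, one_mul]
  · rw [hΔmem] at hb hu ⊢
    rw [mul_pow, inv_pow, hu, hb, inv_one, one_mul]
  · rw [← mul_assoc, inv_mul_cancel, one_mul]
  · rw [← mul_assoc, mul_inv_cancel, one_mul]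

/-- **`π_n = ∏_{b ∈ Δ} (1 - ζ^b)` lies in the `n`-th layer `ℚ_n`** of every cyclotomic `ℤ_p`-extension of `ℚ` (`p` odd, `ζ` any
`p^{n+1}`-th root of unity in `ℚ̄`). [cite: Washington1997, §13.1] -/
theorem IsCyclotomic.prod_one_sub_pow_mem_layer {κ : ZpExtension ℚ p} (hκ : κ.IsCyclotomic) (hp2 : p ≠ 2) (n : ℕ)
    {ζ : AlgebraicClosure ℚ} (hζ : ζ ^ p ^ (n + 1) = 1) :
    haveI : NeZero (p ^ (n + 1)) := ⟨pow_ne_zero _ hp.out.ne_zero⟩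
    (∏ b ∈ Finset.univ.filter (fun b : (ZMod (p ^ (n + 1)))ˣ ↦ b ^ (p - 1) = 1),
        (1 - ζ ^ ((b : ZMod (p ^ (n + 1)))).val)) ∈ κ.layer n := by
  haveI : NeZero (p ^ (n + 1)) := ⟨pow_ne_zero _ hp.out.ne_zero⟩
  change _ ∈ IntermediateField.fixedField _
  rw [IntermediateField.mem_fixedField_iff]
  rintro f ⟨σ, hσ, rfl⟩
  exact hκ.smul_prod_one_sub_pow_of_mem_layerSubgroup hp2 n hζ hσ

end Literature.NumberTheory.EllipticCurves.ZpExtension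

end
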